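import Mathlib

/-!
# GaussWilsonBlock — Gauss's generalisation of Wilson's theorem for odd prime powers and the UNIT-BLOCK LAW
`∏_{a < i ≤ a + p^e, p ∤ i} i ≡ −1 (mod p^e)` (zi-p2 THEOREM 7 LEMMA 3 input; cell zeta5-irr)

HONEST FRAMING: systematic search; no irrationality claim unless certified. INSTRUMENT lemma of the ζ(5)
census cell zeta5-irr (HOME `run/shared/lean/pub/zeta5-irr/`; memo `zi-p2/LEMMAS.md` §B8-a⁗ THEOREM 7, proof
`zi-p2/probes/B8/thm7/THEOREM7.md` LEMMA 3 (iv)/(v): digit-locality of the multipliers `λ_K` via unit factorials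
`N!_p`). Nothing here is about ζ(5); no irrationality content; filing moves no rung. WRITTEN by the planner seat zi-p2
(g12, HOME `zi-p2/SketchT7.lean` v2, namespace `ZiP2.B8.T7`, offered for the tree HOME INBOX 2026-08-27T03:50:17Z);
filed VERBATIM (namespace renamed, the THEOREM-7-specific level-bound `L0` omitted) by the engine seat zi-eng (g8).

## The statement

* `unitBlockProd p a b = ∏_{a < i ≤ b, p ∤ i} i`, `unitFactorial p N = N!_p := ∏_{i ≤ N, p ∤ i} i`.
* `sq_eq_one_iff_of_odd_prime_pow`: the square roots of `1` in `ℤ/p^e` (`p ≥ 3` prime, `e ≥ 1`) are `±1`.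
* **`prod_units_eq_neg_one`** (Gauss, Disquisitiones §78): `∏_{u ∈ (ℤ/p^e)ˣ} u = −1` for `p ≥ 3`, `e ≥ 1`.
* **`unitBlockProd_eq_neg_one`** (zi-p2's `GaussWilsonBlock`): `∏_{a < i ≤ a+p^e, p ∤ i} i = −1` in `ZMod (p^e)`, all `a`.
* `unitFactorial_add_pow_eq_neg` (zi-p2's `UnitFactorialShift`): `(N + p^e)!_p = −N!_p`; `unitFactorial_shift_iter`:
  `(N + p^e·t)!_p = (−1)^t·N!_p`; `legendre_digit_strip`: `v_p((pM+m)!) = M + v_p(M!)` (`m < p`, Mathlib combined).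
-/

namespace Summit.KontsevichZagierPeriods.Zeta5Search.GaussWilsonBlock

open Finset

/-- the `p`-unit part of a block product: `∏_{a < i ≤ b, p ∤ i} i`. -/
def unitBlockProd (p a b : ℕ) : ℕ := ∏ i ∈ (Ioc a b).filter (fun i => ¬ p ∣ i), i

/-- the unit factorial `N!_p := ∏_{i ≤ N, p ∤ i} i` (THEOREM 7 LEMMA 3 (iii): `λ_K` is a signed product of
`A + 2B` such unit factorials times explicit powers of `p` and of the carry roots). -/
def unitFactorial (p N : ℕ) : ℕ := unitBlockProd p 0 N

/-- the square roots of `1` modulo an odd prime power are `±1` (elementary: `p ∣ v-1` and `p ∣ v+1` would give `p ∣ 2`). -/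
theorem sq_eq_one_iff_of_odd_prime_pow {p e : ℕ} [NeZero (p ^ e)] (hp : p.Prime) (h3 : 3 ≤ p) (he : 1 ≤ e)
    (x : ZMod (p ^ e)) (hx : x * x = 1) : x = 1 ∨ x = -1 := by
  have hpe : p ≤ p ^ e := by
    calc p = p ^ 1 := (pow_one p).symm
      _ ≤ p ^ e := Nat.pow_le_pow_right hp.pos he
  have hn1 : 1 < p ^ e := lt_of_lt_of_le (by omega) hpe
  haveI : Fact (1 < p ^ e) := ⟨hn1⟩
  have hxv : ((x.val : ℕ) : ZMod (p ^ e)) = x := ZMod.natCast_zmod_val x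
  set v := x.val with hvdef
  have hv : v < p ^ e := x.val_lt
  have hx' : ((v * v : ℕ) : ZMod (p ^ e)) = ((1 : ℕ) : ZMod (p ^ e)) := by
    push_cast; rw [hxv]; exact hx
  have hv1 : 1 ≤ v := by
    by_contra h0
    have h00 : v = 0 := by omega
    rw [h00] at hx'
    simp at hx'
  have hmod : v * v ≡ 1 [MOD p ^ e] := (ZMod.natCast_eq_natCast_iff _ _ _).mp hx'
  have hvv : 1 ≤ v * v := by simpa using Nat.mul_le_mul hv1 hv1
  have hdvd : p ^ e ∣ v * v - 1 := (Nat.modEq_iff_dvd' hvv).mp hmod.symm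
  have hfac : v * v - 1 = (v - 1) * (v + 1) := by
    zify [hv1, hvv]
    ring
  rw [hfac] at hdvd
  have hnot : ¬ (p ∣ v - 1 ∧ p ∣ v + 1) := by
    rintro ⟨h1, h2⟩
    have h22 : p ∣ (v + 1) - (v - 1) := Nat.dvd_sub h2 h1
    have : (v + 1) - (v - 1) = 2 := by omega
    rw [this] at h22
    have := Nat.le_of_dvd (by norm_num) h22
    omega
  by_cases hA : p ∣ v - 1
  · have hB : ¬ p ∣ v + 1 := fun h => hnot ⟨hA, h⟩
    have hc : Nat.Coprime (p ^ e) (v + 1) :=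
      Nat.Coprime.pow_left e ((Nat.Prime.coprime_iff_not_dvd hp).mpr hB)
    have h1 : p ^ e ∣ v - 1 := hc.dvd_of_dvd_mul_right hdvd
    left
    have hz : ((v - 1 : ℕ) : ZMod (p ^ e)) = 0 := (ZMod.natCast_eq_zero_iff _ _).mpr h1
    have hvz : ((v : ℕ) : ZMod (p ^ e)) = ((v - 1 : ℕ) : ZMod (p ^ e)) + 1 := by
      rw [show ((v : ℕ) : ZMod (p ^ e)) = ((v - 1 + 1 : ℕ) : ZMod (p ^ e)) by rw [Nat.sub_add_cancel hv1]]
      push_cast; ring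
    rw [← hxv, hvz, hz, zero_add]
  · have hc : Nat.Coprime (p ^ e) (v - 1) :=
      Nat.Coprime.pow_left e ((Nat.Prime.coprime_iff_not_dvd hp).mpr hA)
    have h1 : p ^ e ∣ v + 1 := hc.dvd_of_dvd_mul_left hdvd
    right
    have hz : ((v + 1 : ℕ) : ZMod (p ^ e)) = 0 := (ZMod.natCast_eq_zero_iff _ _).mpr h1
    have hz' : ((v : ℕ) : ZMod (p ^ e)) + 1 = 0 := by push_cast at hz; exact hz
    rw [← hxv]
    exact eq_neg_of_add_eq_zero_left hz'

/-- GAUSS'S GENERALISATION OF WILSON'S THEOREM (odd prime powers): the product of all units of `ℤ/p^e` is `-1`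
(pairing `u ↦ u⁻¹` via `Finset.prod_involution`, the fixed points being exactly `±1` by the previous lemma). -/
theorem prod_units_eq_neg_one {p e : ℕ} [NeZero (p ^ e)] (hp : p.Prime) (h3 : 3 ≤ p) (he : 1 ≤ e) :
    ∏ u : (ZMod (p ^ e))ˣ, (u : ZMod (p ^ e)) = -1 := by
  classical
  have key : ∀ u : (ZMod (p ^ e))ˣ, u⁻¹ = u → u = 1 ∨ u = -1 := by
    intro u h
    have hsq : (u : ZMod (p ^ e)) * u = 1 := by
      have h' := u.mul_inv
      rw [h] at h'
      exact h'
    rcases sq_eq_one_iff_of_odd_prime_pow hp h3 he (u : ZMod (p ^ e)) hsq with h1 | h2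
    · left; exact Units.ext (by simpa using h1)
    · right; exact Units.ext (by simpa using h2)
  have hprod : ∏ u : (ZMod (p ^ e))ˣ, u = -1 := by
    have h1 : (∏ x ∈ (univ : Finset (ZMod (p ^ e))ˣ).erase (-1), x) = 1 := by
      refine prod_involution (fun x _ => x⁻¹) (by simp) ?_ ?_ (by simp)
      · intro a ha hne heq
        rcases key a heq with h | h
        · exact hne h
        · exact (Finset.mem_erase.mp ha).1 h
      · intro a ha
        refine Finset.mem_erase.mpr ⟨?_, mem_univ _⟩
        intro h
        have : a = -1 := by rw [← inv_inv a, h]; simp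
        exact (Finset.mem_erase.mp ha).1 this
    rw [← insert_erase (mem_univ (-1 : (ZMod (p ^ e))ˣ)), prod_insert (notMem_erase _ _), h1, mul_one]
  have := congrArg (fun u : (ZMod (p ^ e))ˣ => (u : ZMod (p ^ e))) hprod
  simpa using this

/-- **THE GAUSS–WILSON BLOCK LAW**: for a prime `p ≥ 3`, `e ≥ 1` and every `a`,
`∏_{a < i ≤ a + p^e, p ∤ i} i = −1` in `ZMod (p^e)` (the members of `(a, a+p^e]` prime to `p` map bijectively onto
`(ZMod (p^e))ˣ`: injective = distinct residues in a window of length `p^e`; surjective = explicit representative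
`a − a % p^e + v (+ p^e)`). -/
theorem unitBlockProd_eq_neg_one (p e a : ℕ) (hp : p.Prime) (h3 : 3 ≤ p) (he : 1 ≤ e) :
    (unitBlockProd p a (a + p ^ e) : ZMod (p ^ e)) = -1 := by
  classical
  have hpe : p ≤ p ^ e := by
    calc p = p ^ 1 := (pow_one p).symm
      _ ≤ p ^ e := Nat.pow_le_pow_right hp.pos he
  have hn1 : 1 < p ^ e := lt_of_lt_of_le (by omega) hpe
  haveI : NeZero (p ^ e) := ⟨by omega⟩
  have hpn : p ∣ p ^ e := dvd_pow_self p (by omega)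
  have cop : ∀ i ∈ (Ioc a (a + p ^ e)).filter (fun i => ¬ p ∣ i), Nat.Coprime i (p ^ e) := by
    intro i hi
    have hnd : ¬ p ∣ i := (mem_filter.mp hi).2
    exact Nat.Coprime.pow_right e ((Nat.Prime.coprime_iff_not_dvd hp).mpr hnd).symm
  set n := p ^ e with hn
  unfold unitBlockProd
  rw [Nat.cast_prod, ← prod_units_eq_neg_one hp h3 he]
  refine prod_bij (fun i hi => ZMod.unitOfCoprime i (cop i hi)) (fun _ _ => mem_univ _) ?_ ?_ ?_
  · -- injective
    intro i₁ h₁ i₂ h₂ heq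
    have hc : ((i₁ : ℕ) : ZMod n) = ((i₂ : ℕ) : ZMod n) := by
      have := congrArg (fun u : (ZMod n)ˣ => (u : ZMod n)) heq
      simpa [ZMod.coe_unitOfCoprime] using this
    have hm : i₁ % n = i₂ % n := (ZMod.natCast_eq_natCast_iff' _ _ _).mp hc
    have b₁ := mem_Ioc.mp (mem_filter.mp h₁).1
    have b₂ := mem_Ioc.mp (mem_filter.mp h₂).1
    have hm' : (i₁ - (a + 1)) ≡ (i₂ - (a + 1)) [MOD n] := by
      have h' : (i₁ - (a + 1)) + (a + 1) ≡ (i₂ - (a + 1)) + (a + 1) [MOD n] := by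
        rw [show i₁ - (a + 1) + (a + 1) = i₁ by omega, show i₂ - (a + 1) + (a + 1) = i₂ by omega]
        exact hm
      exact Nat.ModEq.add_right_cancel' (a + 1) h'
    have := Nat.ModEq.eq_of_lt_of_lt hm' (by omega) (by omega)
    omega
  · -- surjective
    intro u _
    set v := (u : ZMod n).val with hv
    have hvn : v < n := (u : ZMod n).val_lt
    have hvc : Nat.Coprime v n := ZMod.val_coe_unit_coprime u
    have hqr : n * (a / n) + a % n = a := Nat.div_add_mod a n
    set q := a / n with hq
    set r := a % n with hrdef
    have hr : r < n := Nat.mod_lt a (by omega)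
    have hra : r ≤ a := Nat.mod_le a n
    have har : a - r = n * q := by rw [← hqr, Nat.add_sub_cancel]
    have hpv : ¬ p ∣ v := by
      intro h
      have hg := Nat.dvd_gcd h hpn
      rw [hvc.gcd_eq_one] at hg
      exact hp.one_lt.ne' (Nat.dvd_one.mp hg)
    have hpar : p ∣ a - r := by rw [har]; exact Dvd.dvd.mul_right hpn q
    have castv : ∀ i : ℕ, ((i : ℕ) : ZMod n) = (v : ZMod n) →
        ∀ hi : i ∈ (Ioc a (a + n)).filter (fun i => ¬ p ∣ i), ZMod.unitOfCoprime i (cop i hi) = u := by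
      intro i hi hmem
      apply Units.ext
      rw [ZMod.coe_unitOfCoprime, hi, hv, ZMod.natCast_zmod_val]
    by_cases hrv : r < v
    · have hmem : a - r + v ∈ (Ioc a (a + n)).filter (fun i => ¬ p ∣ i) := by
        refine mem_filter.mpr ⟨mem_Ioc.mpr ⟨by omega, by omega⟩, ?_⟩
        intro h; exact hpv ((Nat.dvd_add_right hpar).mp h)
      have hcast : (((a - r + v : ℕ)) : ZMod n) = (v : ZMod n) := by
        rw [har]; push_cast; simp
      exact ⟨a - r + v, hmem, castv _ hcast hmem⟩
    · have hmem : a - r + n + v ∈ (Ioc a (a + n)).filter (fun i => ¬ p ∣ i) := by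
        refine mem_filter.mpr ⟨mem_Ioc.mpr ⟨by omega, by omega⟩, ?_⟩
        intro h
        have h' : p ∣ a - r + n := Dvd.dvd.add hpar hpn
        exact hpv ((Nat.dvd_add_right h').mp h)
      have hcast : (((a - r + n + v : ℕ)) : ZMod n) = (v : ZMod n) := by
        rw [har]; push_cast; simp
      exact ⟨a - r + n + v, hmem, castv _ hcast hmem⟩
  · intro i hi
    simp [ZMod.coe_unitOfCoprime]

/-- COROLLARY used in LEMMA 3 (v) (digit-locality of `λ_K` mod `p^e`): shifting the upper end of a unit factorial by
one block of length `p^e` multiplies it by `-1` mod `p^e`: `(N + p^e)!_p = −N!_p` in `ZMod (p^e)`. -/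
theorem unitFactorial_add_pow_eq_neg (p e N : ℕ) (hp : p.Prime) (h3 : 3 ≤ p) (he : 1 ≤ e) :
    (unitFactorial p (N + p ^ e) : ZMod (p ^ e)) = -(unitFactorial p N : ZMod (p ^ e)) := by
  have hsplit : unitFactorial p (N + p ^ e) = unitFactorial p N * unitBlockProd p N (N + p ^ e) := by
    unfold unitFactorial unitBlockProd
    rw [← prod_union]
    · congr 1
      ext i
      simp only [mem_filter, mem_Ioc, mem_union]
      constructor
      · rintro ⟨⟨h0, hi⟩, hnd⟩
        by_cases hiN : i ≤ N
        · exact Or.inl ⟨⟨h0, hiN⟩, hnd⟩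
        · exact Or.inr ⟨⟨by omega, hi⟩, hnd⟩
      · rintro (⟨⟨h0, hi⟩, hnd⟩ | ⟨⟨h0, hi⟩, hnd⟩)
        · exact ⟨⟨h0, by omega⟩, hnd⟩
        · exact ⟨⟨by omega, hi⟩, hnd⟩
    · rw [disjoint_left]
      intro i hi hi'
      simp only [mem_filter, mem_Ioc] at hi hi'
      omega
  rw [hsplit, Nat.cast_mul, unitBlockProd_eq_neg_one p e N hp h3 he, mul_neg_one]

/-- iterated shift (the form used in LEMMA 3 (v)): `(N + p^e·t)!_p ≡ (-1)^t · N!_p (mod p^e)`. -/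
theorem unitFactorial_shift_iter (p e N t : ℕ) (hp : p.Prime) (h3 : 3 ≤ p) (he : 1 ≤ e) :
    (unitFactorial p (N + p ^ e * t) : ZMod (p ^ e)) = (-1) ^ t * (unitFactorial p N : ZMod (p ^ e)) := by
  induction t with
  | zero => simp
  | succ t ih =>
    rw [show N + p ^ e * (t + 1) = (N + p ^ e * t) + p ^ e by ring,
      unitFactorial_add_pow_eq_neg p e (N + p ^ e * t) hp h3 he, ih, pow_succ]
    ring

/-- kernel-checked instances of the block law (`decide` on the defining products). -/
example : (unitBlockProd 5 0 5 : ZMod 5) = -1 := by decide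
example : (unitBlockProd 5 3 8 : ZMod 5) = -1 := by decide
example : (unitBlockProd 5 0 25 : ZMod 25) = -1 := by decide
example : (unitBlockProd 5 7 32 : ZMod 25) = -1 := by decide
example : (unitBlockProd 7 2 9 : ZMod 7) = -1 := by decide

/-- LEGENDRE DIGIT-STRIPPING in the exact form used by LEMMA 2 (`v_p((pM+m)!) = M + v_p(M!)`, `m < p`): the
two Mathlib lemmas cited in the header, combined (no new content). -/
theorem legendre_digit_strip (p M m : ℕ) [Fact p.Prime] (hm : m < p) :
    padicValNat p (p * M + m).factorial = M + padicValNat p M.factorial := by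
  rw [padicValNat_factorial_mul_add M hm, padicValNat_factorial_mul, add_comm]

end Summit.KontsevichZagierPeriods.Zeta5Search.GaussWilsonBlock
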